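import Summits.Ventures.Crystal3D.Theorems.StickyWulffConstantNoReconstructionGainSlabRungs
import HarnessLib

/-!
# Single-family Barlow films of ANY `{111}` family, both hemispheres: the slab-form rungs by lattice symmetry

HONEST FRAMING. Part of the venture `Summits/Ventures/Crystal3D` (cell `crystal3d-full`), helper
`--supports` the crux `NoReconstructionGain` (stmt-Ventures-19144, route
`route-Ventures-StickyWulffConstant`), line `adhesion`; continuation of `…SlabRungs` (the three regimes
in SLAB FORM for the basal family, `ν₃ ≥ 0`: `R = 2`, `C = 18432`, no closure hypothesis) with the
transport pattern of `…BasalBarlowFilmOrbit` / `…ClosureOrbit`.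

* `slabRung_transport` — generic: a slab-form rung with regime predicate `Reg ν` for films in `B`
  transports along any linear isometry `g` with `g Λ₀ = Λ₀` to films in `g B = Λ₀ ∪ (Λ₀ ± g w)` and
  regime `Reg (g⁻¹ ν)`;
* `nTiltBarlowFilm_slab_orbit`, `oneOverhangBarlowFilm_slab_orbit`, `twoOverhangBarlowFilm_slab_orbit`
  (**rungs**, registered by name): regimes `C = 0, 1, 2` for the family `g e₃` (hollow vectors
  `g w, g (w − u), g (w − v)`, `α = √(2/3) ⟪ν, g e₃⟫ ≥ 0`).  `g = −1` covers `ν₃ ≤ 0` for the basal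
  family; lattice rotations cover the other three families.

NET: for EVERY unit normal `ν` and EVERY one of the four `{111}` families, off the tie circles
`√(2/3)⟪ν, g e₃⟫ + ⟪g τ, ν⟫ = 0` (and `⟪ν, g e₃⟫ = 0` handled by either sign), every film on that
family's Barlow positions above the cut of the `ν`-slab sample (`R = 2`) satisfies the atom:
`#cross ≤ D + 18432 ρ` — class (i) of the crux's census, unconditionally.

WHAT THIS IS NOT: the tie circles; films mixing families; off-Barlow films; rung F-C1 not moved.
-/


noncomputable section

namespace Summit.Ventures.Crystal3D.Theorems

open Summit.Ventures.Crystal3D Finset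
open Literature.MathematicalPhysics.StatisticalMechanics (barlowPos fccStacking barlowOffset layerNormal constHagg
  contactDeficiency)
open scoped InnerProductSpace

/-- **Transport of a slab-form rung along a lattice symmetry.**  `Reg` is the regime predicate. -/
theorem slabRung_transport (Reg : EuclideanSpace ℝ (Fin 3) → Prop)
    (hT : ∃ R C : ℝ, 1 ≤ R ∧ ∀ ν : EuclideanSpace ℝ (Fin 3), ‖ν‖ = 1 → ∀ ρ : ℝ, R ≤ ρ →
      ∀ X P : Finset (EuclideanSpace ℝ (Fin 3)),
      (∀ p ∈ X, ∀ q ∈ X, p ≠ q → 1 ≤ dist p q) → P ⊆ X →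
      (∀ p, p ∈ P ↔ (p ∈ fccStacking 1 (Real.sqrt (2 / 3)) ∧ -(2 * R) ≤ ⟪p, ν⟫_ℝ ∧
        ⟪p, ν⟫_ℝ ≤ -R ∧ ‖p‖ ^ 2 - ⟪p, ν⟫_ℝ ^ 2 ≤ ρ ^ 2)) →
      Reg ν →
      (∀ q ∈ X \ P, q ∈ fccStacking 1 (Real.sqrt (2 / 3)) ∨
        q - barlowOffset 1 ∈ fccStacking 1 (Real.sqrt (2 / 3)) ∨
        q + barlowOffset 1 ∈ fccStacking 1 (Real.sqrt (2 / 3))) →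
      (∀ q ∈ X \ P, -R < ⟪q, ν⟫_ℝ) →
      ((((P ×ˢ (X \ P)).filter fun pq => dist pq.1 pq.2 = 1).card : ℕ) : ℝ) ≤
        contactDeficiency (X \ P) + C * ρ) :
    ∃ R C : ℝ, 1 ≤ R ∧ ∀ ν : EuclideanSpace ℝ (Fin 3), ‖ν‖ = 1 → ∀ ρ : ℝ, R ≤ ρ →
      ∀ X P : Finset (EuclideanSpace ℝ (Fin 3)),
      (∀ p ∈ X, ∀ q ∈ X, p ≠ q → 1 ≤ dist p q) → P ⊆ X →
      (∀ p, p ∈ P ↔ (p ∈ fccStacking 1 (Real.sqrt (2 / 3)) ∧ -(2 * R) ≤ ⟪p, ν⟫_ℝ ∧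
        ⟪p, ν⟫_ℝ ≤ -R ∧ ‖p‖ ^ 2 - ⟪p, ν⟫_ℝ ^ 2 ≤ ρ ^ 2)) →
      ∀ g : EuclideanSpace ℝ (Fin 3) ≃ₗᵢ[ℝ] EuclideanSpace ℝ (Fin 3),
      (∀ p ∈ fccStacking 1 (Real.sqrt (2 / 3)), g p ∈ fccStacking 1 (Real.sqrt (2 / 3))) →
      (∀ p ∈ fccStacking 1 (Real.sqrt (2 / 3)), g.symm p ∈ fccStacking 1 (Real.sqrt (2 / 3))) →
      Reg (g.symm ν) →
      (∀ q ∈ X \ P, q ∈ fccStacking 1 (Real.sqrt (2 / 3)) ∨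
        q - g (barlowOffset 1) ∈ fccStacking 1 (Real.sqrt (2 / 3)) ∨
        q + g (barlowOffset 1) ∈ fccStacking 1 (Real.sqrt (2 / 3))) →
      (∀ q ∈ X \ P, -R < ⟪q, ν⟫_ℝ) →
      ((((P ×ˢ (X \ P)).filter fun pq => dist pq.1 pq.2 = 1).card : ℕ) : ℝ) ≤
        contactDeficiency (X \ P) + C * ρ := by
  classical
  obtain ⟨R, C, hR, h⟩ := hT
  refine ⟨R, C, hR, fun ν hν ρ hρ X P hX hPX hP g hg hg' hreg hfilm habove => ?_⟩
  have hgi : Isometry (g.symm : EuclideanSpace ℝ (Fin 3) → EuclideanSpace ℝ (Fin 3)) := g.symm.isometry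
  have hinj : Function.Injective (g.symm : EuclideanSpace ℝ (Fin 3) → EuclideanSpace ℝ (Fin 3)) :=
    g.symm.injective
  set X' := X.image g.symm with hX'
  set P' := P.image g.symm with hP'def
  set ν' := g.symm ν with hν'
  have hsd : X' \ P' = (X \ P).image g.symm := by
    rw [hX', hP'def, image_sdiff_of_injOn hinj.injOn hPX]
  have hXp : ∀ p ∈ X', ∀ q ∈ X', p ≠ q → 1 ≤ dist p q := by
    intro p hp q hq hpq
    obtain ⟨p₀, hp₀, rfl⟩ := mem_image.1 hp
    obtain ⟨q₀, hq₀, rfl⟩ := mem_image.1 hq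
    rw [hgi.dist_eq]
    exact hX p₀ hp₀ q₀ hq₀ fun e => hpq (by rw [e])
  have hPXp : P' ⊆ X' := image_subset_image hPX
  have hinn : ∀ p, ⟪g.symm p, ν'⟫_ℝ = ⟪p, ν⟫_ℝ := fun p => by
    rw [hν', LinearIsometryEquiv.inner_map_map]
  have hνn : ‖ν'‖ = 1 := by rw [hν', LinearIsometryEquiv.norm_map, hν]
  have hPp : ∀ p, p ∈ P' ↔ (p ∈ fccStacking 1 (Real.sqrt (2 / 3)) ∧ -(2 * R) ≤ ⟪p, ν'⟫_ℝ ∧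
      ⟪p, ν'⟫_ℝ ≤ -R ∧ ‖p‖ ^ 2 - ⟪p, ν'⟫_ℝ ^ 2 ≤ ρ ^ 2) := by
    intro p
    rw [hP'def, mem_image]
    constructor
    · rintro ⟨p₀, hp₀, rfl⟩
      obtain ⟨hΛ, h1, h2, h3⟩ := (hP p₀).1 hp₀
      refine ⟨hg' p₀ hΛ, ?_, ?_, ?_⟩
      · rw [hinn]; exact h1
      · rw [hinn]; exact h2
      · rw [hinn, LinearIsometryEquiv.norm_map]; exact h3
    · rintro ⟨hΛ, h1, h2, h3⟩
      have hi : ⟪g p, ν⟫_ℝ = ⟪p, ν'⟫_ℝ := by rw [← hinn (g p), LinearIsometryEquiv.symm_apply_apply]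
      refine ⟨g p, (hP (g p)).2 ⟨hg p hΛ, ?_, ?_, ?_⟩, g.symm_apply_apply p⟩
      · rw [hi]; exact h1
      · rw [hi]; exact h2
      · rw [hi, LinearIsometryEquiv.norm_map]; exact h3
  have hfilm' : ∀ q ∈ X' \ P', q ∈ fccStacking 1 (Real.sqrt (2 / 3)) ∨
      q - barlowOffset 1 ∈ fccStacking 1 (Real.sqrt (2 / 3)) ∨
      q + barlowOffset 1 ∈ fccStacking 1 (Real.sqrt (2 / 3)) := by
    intro q hq
    rw [hsd] at hq
    obtain ⟨q₀, hq₀, rfl⟩ := mem_image.1 hq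
    rcases hfilm q₀ hq₀ with h0 | h1 | h2
    · exact Or.inl (hg' q₀ h0)
    · refine Or.inr (Or.inl ?_)
      have : g.symm q₀ - barlowOffset 1 = g.symm (q₀ - g (barlowOffset 1)) := by
        rw [map_sub, LinearIsometryEquiv.symm_apply_apply]
      rw [this]; exact hg' _ h1
    · refine Or.inr (Or.inr ?_)
      have : g.symm q₀ + barlowOffset 1 = g.symm (q₀ + g (barlowOffset 1)) := by
        rw [map_add, LinearIsometryEquiv.symm_apply_apply]
      rw [this]; exact hg' _ h2
  have habove' : ∀ q ∈ X' \ P', -R < ⟪q, ν'⟫_ℝ := by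
    intro q hq
    rw [hsd] at hq
    obtain ⟨q₀, hq₀, rfl⟩ := mem_image.1 hq
    rw [hinn]; exact habove q₀ hq₀
  have hmain := h ν' hνn ρ hρ X' P' hXp hPXp hPp hreg hfilm' habove'
  rw [hsd, hP'def, card_cross_image_of_isometry hgi, contactDeficiency_image_of_isometry hgi] at hmain
  exact hmain

/-- **Slab form, regime `C = 0`, family `g e₃`** (registered by name). -/
theorem nTiltBarlowFilm_slab_orbit :
    ∃ R C : ℝ, 1 ≤ R ∧ ∀ ν : EuclideanSpace ℝ (Fin 3), ‖ν‖ = 1 → ∀ ρ : ℝ, R ≤ ρ →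
      ∀ X P : Finset (EuclideanSpace ℝ (Fin 3)),
      (∀ p ∈ X, ∀ q ∈ X, p ≠ q → 1 ≤ dist p q) → P ⊆ X →
      (∀ p, p ∈ P ↔ (p ∈ fccStacking 1 (Real.sqrt (2 / 3)) ∧ -(2 * R) ≤ ⟪p, ν⟫_ℝ ∧
        ⟪p, ν⟫_ℝ ≤ -R ∧ ‖p‖ ^ 2 - ⟪p, ν⟫_ℝ ^ 2 ≤ ρ ^ 2)) →
      ∀ g : EuclideanSpace ℝ (Fin 3) ≃ₗᵢ[ℝ] EuclideanSpace ℝ (Fin 3),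
      (∀ p ∈ fccStacking 1 (Real.sqrt (2 / 3)), g p ∈ fccStacking 1 (Real.sqrt (2 / 3))) →
      (∀ p ∈ fccStacking 1 (Real.sqrt (2 / 3)), g.symm p ∈ fccStacking 1 (Real.sqrt (2 / 3))) →
      0 ≤ ⟪ν, g (EuclideanSpace.single (2 : Fin 3) (1 : ℝ))⟫_ℝ →
      (∀ τ ∈ ([barlowOffset 1, barlowOffset 1 - barlowPos 1 (Real.sqrt (2 / 3)) constHagg 0 1 0,
          barlowOffset 1 - barlowPos 1 (Real.sqrt (2 / 3)) constHagg 0 0 1] : List (EuclideanSpace ℝ (Fin 3))),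
        0 < Real.sqrt (2 / 3) * ⟪ν, g (EuclideanSpace.single (2 : Fin 3) (1 : ℝ))⟫_ℝ + ⟪g τ, ν⟫_ℝ) →
      (∀ q ∈ X \ P, q ∈ fccStacking 1 (Real.sqrt (2 / 3)) ∨
        q - g (barlowOffset 1) ∈ fccStacking 1 (Real.sqrt (2 / 3)) ∨
        q + g (barlowOffset 1) ∈ fccStacking 1 (Real.sqrt (2 / 3))) →
      (∀ q ∈ X \ P, -R < ⟪q, ν⟫_ℝ) →
      ((((P ×ˢ (X \ P)).filter fun pq => dist pq.1 pq.2 = 1).card : ℕ) : ℝ) ≤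
        contactDeficiency (X \ P) + C * ρ := by
  classical
  have hT := slabRung_transport
    (fun ν => 0 ≤ ν 2 ∧ ∀ τ ∈ ([barlowOffset 1, barlowOffset 1 - barlowPos 1 (Real.sqrt (2 / 3)) constHagg 0 1 0,
          barlowOffset 1 - barlowPos 1 (Real.sqrt (2 / 3)) constHagg 0 0 1] : List (EuclideanSpace ℝ (Fin 3))),
        0 < Real.sqrt (2 / 3) * ν 2 + ⟪τ, ν⟫_ℝ) (by
      obtain ⟨R, C, hR, h⟩ := nTiltBarlowFilm_slab
      exact ⟨R, C, hR, fun ν hν ρ hρ X P hX hPX hP hreg hfilm habove =>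
        h ν hν ρ hρ X P hX hPX hP hreg.1 hreg.2 hfilm habove⟩)
  obtain ⟨R, C, hR, h⟩ := hT
  refine ⟨R, C, hR, fun ν hν ρ hρ X P hX hPX hP g hg hg' h0 hreg => h ν hν ρ hρ X P hX hPX hP g hg hg' ?_⟩
  have e2 : (g.symm ν) 2 = ⟪ν, g (EuclideanSpace.single (2 : Fin 3) (1 : ℝ))⟫_ℝ := by
    have : ⟪g.symm ν, EuclideanSpace.single (2 : Fin 3) (1 : ℝ)⟫_ℝ = (g.symm ν) 2 := by
      simp [EuclideanSpace.inner_single_right]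
    rw [← this, ← g.inner_map_map, LinearIsometryEquiv.apply_symm_apply]
  have et : ∀ τ : EuclideanSpace ℝ (Fin 3), ⟪τ, g.symm ν⟫_ℝ = ⟪g τ, ν⟫_ℝ := fun τ => by
    rw [← g.inner_map_map, LinearIsometryEquiv.apply_symm_apply]
  refine ⟨by rw [e2]; exact h0, fun τ hτ => ?_⟩
  rw [e2, et]
  exact hreg τ hτ

/-- **Slab form, regime `C = 1`, family `g e₃`** (registered by name). -/
theorem oneOverhangBarlowFilm_slab_orbit :
    ∃ R C : ℝ, 1 ≤ R ∧ ∀ ν : EuclideanSpace ℝ (Fin 3), ‖ν‖ = 1 → ∀ ρ : ℝ, R ≤ ρ →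
      ∀ X P : Finset (EuclideanSpace ℝ (Fin 3)),
      (∀ p ∈ X, ∀ q ∈ X, p ≠ q → 1 ≤ dist p q) → P ⊆ X →
      (∀ p, p ∈ P ↔ (p ∈ fccStacking 1 (Real.sqrt (2 / 3)) ∧ -(2 * R) ≤ ⟪p, ν⟫_ℝ ∧
        ⟪p, ν⟫_ℝ ≤ -R ∧ ‖p‖ ^ 2 - ⟪p, ν⟫_ℝ ^ 2 ≤ ρ ^ 2)) →
      ∀ g : EuclideanSpace ℝ (Fin 3) ≃ₗᵢ[ℝ] EuclideanSpace ℝ (Fin 3),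
      (∀ p ∈ fccStacking 1 (Real.sqrt (2 / 3)), g p ∈ fccStacking 1 (Real.sqrt (2 / 3))) →
      (∀ p ∈ fccStacking 1 (Real.sqrt (2 / 3)), g.symm p ∈ fccStacking 1 (Real.sqrt (2 / 3))) →
      0 ≤ ⟪ν, g (EuclideanSpace.single (2 : Fin 3) (1 : ℝ))⟫_ℝ →
      ((Real.sqrt (2 / 3) * ⟪ν, g (EuclideanSpace.single (2 : Fin 3) (1 : ℝ))⟫_ℝ + ⟪g (barlowOffset 1), ν⟫_ℝ < 0 ∧
          0 < Real.sqrt (2 / 3) * ⟪ν, g (EuclideanSpace.single (2 : Fin 3) (1 : ℝ))⟫_ℝ + ⟪g (barlowOffset 1 - barlowPos 1 (Real.sqrt (2 / 3)) constHagg 0 1 0), ν⟫_ℝ ∧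
          0 < Real.sqrt (2 / 3) * ⟪ν, g (EuclideanSpace.single (2 : Fin 3) (1 : ℝ))⟫_ℝ + ⟪g (barlowOffset 1 - barlowPos 1 (Real.sqrt (2 / 3)) constHagg 0 0 1), ν⟫_ℝ) ∨
        (Real.sqrt (2 / 3) * ⟪ν, g (EuclideanSpace.single (2 : Fin 3) (1 : ℝ))⟫_ℝ + ⟪g (barlowOffset 1 - barlowPos 1 (Real.sqrt (2 / 3)) constHagg 0 1 0), ν⟫_ℝ < 0 ∧
          0 < Real.sqrt (2 / 3) * ⟪ν, g (EuclideanSpace.single (2 : Fin 3) (1 : ℝ))⟫_ℝ + ⟪g (barlowOffset 1), ν⟫_ℝ ∧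
          0 < Real.sqrt (2 / 3) * ⟪ν, g (EuclideanSpace.single (2 : Fin 3) (1 : ℝ))⟫_ℝ + ⟪g (barlowOffset 1 - barlowPos 1 (Real.sqrt (2 / 3)) constHagg 0 0 1), ν⟫_ℝ) ∨
        (Real.sqrt (2 / 3) * ⟪ν, g (EuclideanSpace.single (2 : Fin 3) (1 : ℝ))⟫_ℝ + ⟪g (barlowOffset 1 - barlowPos 1 (Real.sqrt (2 / 3)) constHagg 0 0 1), ν⟫_ℝ < 0 ∧
          0 < Real.sqrt (2 / 3) * ⟪ν, g (EuclideanSpace.single (2 : Fin 3) (1 : ℝ))⟫_ℝ + ⟪g (barlowOffset 1), ν⟫_ℝ ∧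
          0 < Real.sqrt (2 / 3) * ⟪ν, g (EuclideanSpace.single (2 : Fin 3) (1 : ℝ))⟫_ℝ + ⟪g (barlowOffset 1 - barlowPos 1 (Real.sqrt (2 / 3)) constHagg 0 1 0), ν⟫_ℝ)) →
      (∀ q ∈ X \ P, q ∈ fccStacking 1 (Real.sqrt (2 / 3)) ∨
        q - g (barlowOffset 1) ∈ fccStacking 1 (Real.sqrt (2 / 3)) ∨
        q + g (barlowOffset 1) ∈ fccStacking 1 (Real.sqrt (2 / 3))) →
      (∀ q ∈ X \ P, -R < ⟪q, ν⟫_ℝ) →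
      ((((P ×ˢ (X \ P)).filter fun pq => dist pq.1 pq.2 = 1).card : ℕ) : ℝ) ≤
        contactDeficiency (X \ P) + C * ρ := by
  classical
  have hT := slabRung_transport
    (fun ν => 0 ≤ ν 2 ∧ (((Real.sqrt (2 / 3) * ν 2 + ⟪barlowOffset 1, ν⟫_ℝ < 0 ∧
          0 < Real.sqrt (2 / 3) * ν 2 + ⟪barlowOffset 1 - barlowPos 1 (Real.sqrt (2 / 3)) constHagg 0 1 0, ν⟫_ℝ ∧
          0 < Real.sqrt (2 / 3) * ν 2 + ⟪barlowOffset 1 - barlowPos 1 (Real.sqrt (2 / 3)) constHagg 0 0 1, ν⟫_ℝ) ∨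
        (Real.sqrt (2 / 3) * ν 2 + ⟪barlowOffset 1 - barlowPos 1 (Real.sqrt (2 / 3)) constHagg 0 1 0, ν⟫_ℝ < 0 ∧
          0 < Real.sqrt (2 / 3) * ν 2 + ⟪barlowOffset 1, ν⟫_ℝ ∧
          0 < Real.sqrt (2 / 3) * ν 2 + ⟪barlowOffset 1 - barlowPos 1 (Real.sqrt (2 / 3)) constHagg 0 0 1, ν⟫_ℝ) ∨
        (Real.sqrt (2 / 3) * ν 2 + ⟪barlowOffset 1 - barlowPos 1 (Real.sqrt (2 / 3)) constHagg 0 0 1, ν⟫_ℝ < 0 ∧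
          0 < Real.sqrt (2 / 3) * ν 2 + ⟪barlowOffset 1, ν⟫_ℝ ∧
          0 < Real.sqrt (2 / 3) * ν 2 + ⟪barlowOffset 1 - barlowPos 1 (Real.sqrt (2 / 3)) constHagg 0 1 0, ν⟫_ℝ)))) (by
      obtain ⟨R, C, hR, h⟩ := oneOverhangBarlowFilm_slab
      exact ⟨R, C, hR, fun ν hν ρ hρ X P hX hPX hP hreg hfilm habove =>
        h ν hν ρ hρ X P hX hPX hP hreg.1 hreg.2 hfilm habove⟩)
  obtain ⟨R, C, hR, h⟩ := hT
  refine ⟨R, C, hR, fun ν hν ρ hρ X P hX hPX hP g hg hg' h0 hreg => h ν hν ρ hρ X P hX hPX hP g hg hg' ?_⟩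
  have e2 : (g.symm ν) 2 = ⟪ν, g (EuclideanSpace.single (2 : Fin 3) (1 : ℝ))⟫_ℝ := by
    have : ⟪g.symm ν, EuclideanSpace.single (2 : Fin 3) (1 : ℝ)⟫_ℝ = (g.symm ν) 2 := by
      simp [EuclideanSpace.inner_single_right]
    rw [← this, ← g.inner_map_map, LinearIsometryEquiv.apply_symm_apply]
  have et : ∀ τ : EuclideanSpace ℝ (Fin 3), ⟪τ, g.symm ν⟫_ℝ = ⟪g τ, ν⟫_ℝ := fun τ => by
    rw [← g.inner_map_map, LinearIsometryEquiv.apply_symm_apply]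
  refine ⟨by rw [e2]; exact h0, ?_⟩
  simp only [et, e2]
  exact hreg

/-- **Slab form, regime `C = 2`, family `g e₃`** (registered by name). -/
theorem twoOverhangBarlowFilm_slab_orbit :
    ∃ R C : ℝ, 1 ≤ R ∧ ∀ ν : EuclideanSpace ℝ (Fin 3), ‖ν‖ = 1 → ∀ ρ : ℝ, R ≤ ρ →
      ∀ X P : Finset (EuclideanSpace ℝ (Fin 3)),
      (∀ p ∈ X, ∀ q ∈ X, p ≠ q → 1 ≤ dist p q) → P ⊆ X →
      (∀ p, p ∈ P ↔ (p ∈ fccStacking 1 (Real.sqrt (2 / 3)) ∧ -(2 * R) ≤ ⟪p, ν⟫_ℝ ∧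
        ⟪p, ν⟫_ℝ ≤ -R ∧ ‖p‖ ^ 2 - ⟪p, ν⟫_ℝ ^ 2 ≤ ρ ^ 2)) →
      ∀ g : EuclideanSpace ℝ (Fin 3) ≃ₗᵢ[ℝ] EuclideanSpace ℝ (Fin 3),
      (∀ p ∈ fccStacking 1 (Real.sqrt (2 / 3)), g p ∈ fccStacking 1 (Real.sqrt (2 / 3))) →
      (∀ p ∈ fccStacking 1 (Real.sqrt (2 / 3)), g.symm p ∈ fccStacking 1 (Real.sqrt (2 / 3))) →
      0 ≤ ⟪ν, g (EuclideanSpace.single (2 : Fin 3) (1 : ℝ))⟫_ℝ →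
      ((0 < Real.sqrt (2 / 3) * ⟪ν, g (EuclideanSpace.single (2 : Fin 3) (1 : ℝ))⟫_ℝ + ⟪g (barlowOffset 1), ν⟫_ℝ ∧
          Real.sqrt (2 / 3) * ⟪ν, g (EuclideanSpace.single (2 : Fin 3) (1 : ℝ))⟫_ℝ + ⟪g (barlowOffset 1 - barlowPos 1 (Real.sqrt (2 / 3)) constHagg 0 1 0), ν⟫_ℝ < 0 ∧
          Real.sqrt (2 / 3) * ⟪ν, g (EuclideanSpace.single (2 : Fin 3) (1 : ℝ))⟫_ℝ + ⟪g (barlowOffset 1 - barlowPos 1 (Real.sqrt (2 / 3)) constHagg 0 0 1), ν⟫_ℝ < 0) ∨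
        (0 < Real.sqrt (2 / 3) * ⟪ν, g (EuclideanSpace.single (2 : Fin 3) (1 : ℝ))⟫_ℝ + ⟪g (barlowOffset 1 - barlowPos 1 (Real.sqrt (2 / 3)) constHagg 0 1 0), ν⟫_ℝ ∧
          Real.sqrt (2 / 3) * ⟪ν, g (EuclideanSpace.single (2 : Fin 3) (1 : ℝ))⟫_ℝ + ⟪g (barlowOffset 1), ν⟫_ℝ < 0 ∧
          Real.sqrt (2 / 3) * ⟪ν, g (EuclideanSpace.single (2 : Fin 3) (1 : ℝ))⟫_ℝ + ⟪g (barlowOffset 1 - barlowPos 1 (Real.sqrt (2 / 3)) constHagg 0 0 1), ν⟫_ℝ < 0) ∨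
        (0 < Real.sqrt (2 / 3) * ⟪ν, g (EuclideanSpace.single (2 : Fin 3) (1 : ℝ))⟫_ℝ + ⟪g (barlowOffset 1 - barlowPos 1 (Real.sqrt (2 / 3)) constHagg 0 0 1), ν⟫_ℝ ∧
          Real.sqrt (2 / 3) * ⟪ν, g (EuclideanSpace.single (2 : Fin 3) (1 : ℝ))⟫_ℝ + ⟪g (barlowOffset 1), ν⟫_ℝ < 0 ∧
          Real.sqrt (2 / 3) * ⟪ν, g (EuclideanSpace.single (2 : Fin 3) (1 : ℝ))⟫_ℝ + ⟪g (barlowOffset 1 - barlowPos 1 (Real.sqrt (2 / 3)) constHagg 0 1 0), ν⟫_ℝ < 0)) →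
      (∀ q ∈ X \ P, q ∈ fccStacking 1 (Real.sqrt (2 / 3)) ∨
        q - g (barlowOffset 1) ∈ fccStacking 1 (Real.sqrt (2 / 3)) ∨
        q + g (barlowOffset 1) ∈ fccStacking 1 (Real.sqrt (2 / 3))) →
      (∀ q ∈ X \ P, -R < ⟪q, ν⟫_ℝ) →
      ((((P ×ˢ (X \ P)).filter fun pq => dist pq.1 pq.2 = 1).card : ℕ) : ℝ) ≤
        contactDeficiency (X \ P) + C * ρ := by
  classical
  have hT := slabRung_transport
    (fun ν => 0 ≤ ν 2 ∧ (((0 < Real.sqrt (2 / 3) * ν 2 + ⟪barlowOffset 1, ν⟫_ℝ ∧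
          Real.sqrt (2 / 3) * ν 2 + ⟪barlowOffset 1 - barlowPos 1 (Real.sqrt (2 / 3)) constHagg 0 1 0, ν⟫_ℝ < 0 ∧
          Real.sqrt (2 / 3) * ν 2 + ⟪barlowOffset 1 - barlowPos 1 (Real.sqrt (2 / 3)) constHagg 0 0 1, ν⟫_ℝ < 0) ∨
        (0 < Real.sqrt (2 / 3) * ν 2 + ⟪barlowOffset 1 - barlowPos 1 (Real.sqrt (2 / 3)) constHagg 0 1 0, ν⟫_ℝ ∧
          Real.sqrt (2 / 3) * ν 2 + ⟪barlowOffset 1, ν⟫_ℝ < 0 ∧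
          Real.sqrt (2 / 3) * ν 2 + ⟪barlowOffset 1 - barlowPos 1 (Real.sqrt (2 / 3)) constHagg 0 0 1, ν⟫_ℝ < 0) ∨
        (0 < Real.sqrt (2 / 3) * ν 2 + ⟪barlowOffset 1 - barlowPos 1 (Real.sqrt (2 / 3)) constHagg 0 0 1, ν⟫_ℝ ∧
          Real.sqrt (2 / 3) * ν 2 + ⟪barlowOffset 1, ν⟫_ℝ < 0 ∧
          Real.sqrt (2 / 3) * ν 2 + ⟪barlowOffset 1 - barlowPos 1 (Real.sqrt (2 / 3)) constHagg 0 1 0, ν⟫_ℝ < 0)))) (by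
      obtain ⟨R, C, hR, h⟩ := twoOverhangBarlowFilm_slab
      exact ⟨R, C, hR, fun ν hν ρ hρ X P hX hPX hP hreg hfilm habove =>
        h ν hν ρ hρ X P hX hPX hP hreg.1 hreg.2 hfilm habove⟩)
  obtain ⟨R, C, hR, h⟩ := hT
  refine ⟨R, C, hR, fun ν hν ρ hρ X P hX hPX hP g hg hg' h0 hreg => h ν hν ρ hρ X P hX hPX hP g hg hg' ?_⟩
  have e2 : (g.symm ν) 2 = ⟪ν, g (EuclideanSpace.single (2 : Fin 3) (1 : ℝ))⟫_ℝ := by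
    have : ⟪g.symm ν, EuclideanSpace.single (2 : Fin 3) (1 : ℝ)⟫_ℝ = (g.symm ν) 2 := by
      simp [EuclideanSpace.inner_single_right]
    rw [← this, ← g.inner_map_map, LinearIsometryEquiv.apply_symm_apply]
  have et : ∀ τ : EuclideanSpace ℝ (Fin 3), ⟪τ, g.symm ν⟫_ℝ = ⟪g τ, ν⟫_ℝ := fun τ => by
    rw [← g.inner_map_map, LinearIsometryEquiv.apply_symm_apply]
  refine ⟨by rw [e2]; exact h0, ?_⟩
  simp only [et, e2]
  exact hreg

end Summit.Ventures.Crystal3D.Theorems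

end
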